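/-
Copyright (c) 2026 the pub-hodgecm-mathlib formalisation cell (harness21).  Prover seat hodgecm-mathlib-F0P3a-p06-g25 (PLACE-FREE LAYER P1 after RIDER 2b; the `hd ↦ hϖ`
substitution is «LH5» LH5-p04 (g10)'s certified re-lettering 01:14:50Z∕01:18:12Z; LEAD F0P3a-plan (g16) T15-25 (a)(c), T15-30 (i); G-row dealer F0P3a-p09 (g14) LEDGER v13 OPEN item); 2026-09-03.
-/
import Summits.HodgeConjecture.HodgeConjecture.Theorems.F0P3cStCharTSStLevelsTransport   -- ★ C p853204 (this seat): the `hd`-free half (`coe_eA_apply`, `eA_vec`, `mem_comap_iff`, …) is imported, not restated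
import HarnessLib

/-!
# F0 · P3c · line LH6 «StCharTS» — PLACE-FREE LAYER P1 «LEVELS-PF»: FILE C's four datum-readers over the UNIFORMISER TOKEN `hϖ : |ϖ|_w = exp(−1)` alone
# (`mem_I_of_coe_eq_diagonal`, MACKEY binders `cover_borel_I` ∕ `disj_borel_I` ∕ `cover_borel_K1` — valid at EVERY non-split `v`, unramified or tamely ramified)

Cell `pub/hodgecm-mathlib` (D-0151), FLOOR 0, crux item H413 = `stmt-HodgeConjecture-24833` (`--supports` lane, helper; seat F0P3a-p06 (g25)).  THEOREMS ONLY.  ★ C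
`F0P3cStCharTSStLevelsTransport` states these four over the unramified datum `hd : UnramifiedLocalConjDatum σ_w ϖ` but reads it only through `hd.σσ`, `hd.vσ`, `hd.vϖ`
(«LH5» LH5-p04 (g10)'s find): `σ_w ∘ σ_w = id` and `|σ_w ·|_w = |·|_w` are PLACE-FREE theorems (★ `galAdicCompletionMap_galAdicCompletionMap_of_smul_eq`, ★ `valued_galAdicCompletionMap`),
so the only datum letter is `hϖ : Valued.v ϖ = WithZero.exp (-1 : ℤ)` — the uniformiser token of ★ EXPLICIT-RAM `epFunction_G_explicit_of_ramified` and of ★ NOT-WILD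
`exists_uniformizer_epFunction_G_explicit_of_not_wild` p853198.  Same statements otherwise, same proofs (★★ BRUHAT–IWAHORI `cover_borelU_inf` ∕ `disj_borelU_inf` ∕
`cover_borelU_conj_glInt` take exactly these three facts).  The ★ file is NOT edited (its importers D → E → F → G → H stay byte-stable); this file is the place-free twin the
NOT-WILD EP-PAIRS head (P4 `F0P3cStCharTSEPPairsNotWild`) reads.  HONEST LABEL: count-neutral helper; closes no node; HC_CM is proved only modulo the 7 printed citations
(hLiu418 = stmt-HodgeConjecture-24832, h413 = stmt-HodgeConjecture-24833) until rung 0 closes.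

## References
* [Tits1979] J. Tits, *Reductive groups over local fields*, PSPM 33.1 (1979), §3.7.
* [BruhatTits1972] F. Bruhat, J. Tits, *Groupes réductifs sur un corps local I*, Publ. Math. IHÉS 41 (1972), §10.
* [Rogawski1990] J. D. Rogawski, *Automorphic Representations of Unitary Groups in Three Variables*, Ann. of Math. Stud. 123 (1990), §1.10 p. 9, §12.2 (1) p. 173.
* [PlatonovRapinchuk1994] V. Platonov, A. Rapinchuk, *Algebraic Groups and Number Theory* (1994), §5.1.
-/

set_option autoImplicit false
-- the mandated namespace has the single-problem summit's repeated segment (`HodgeConjecture.HodgeConjecture`)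
set_option linter.dupNamespace false

noncomputable section

open NumberField IsDedekindDomain MeasureTheory
open scoped Matrix MatrixGroups NNReal WithZero
open Literature.NumberTheory.Automorphic Literature.NumberTheory.Automorphic.UnitaryGroup
open Literature.NumberTheory.Rogawski1990 Literature.NumberTheory.GaloisRepresentations

namespace Summit.HodgeConjecture.HodgeConjecture.Cruxes.H413.F0P3cStCharTSStLevelsPF

open Summit.HodgeConjecture.HodgeConjecture.Cruxes.H413
open Summit.HodgeConjecture.HodgeConjecture.Cruxes.H413.F0P3cStCharTSStLevelsTransport

variable (L : Type) [Field L] [NumberField L] [IsCMField L] (v : HeightOneSpectrum (𝓞 ↥(maximalRealSubfield L)))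
  (w : PlacesOver L v) (hw : IsCMField.complexConj L • w.1 = w.1)
  (eA : Gqs L v ≃ₜ* ↥(unitaryGroupOfForm (galAdicCompletionMap (L := L) (IsCMField.complexConj L) hw) ((StdForm.antidiagonal 3).over (w.1.adicCompletion L))))
  (heA : ∀ g : Gqs L v,
    ((eA g : ↥(unitaryGroupOfForm (galAdicCompletionMap (L := L) (IsCMField.complexConj L) hw) ((StdForm.antidiagonal 3).over (w.1.adicCompletion L)))) :
        GL (Fin 3) (w.1.adicCompletion L)) =
      ((localNonsplitEquiv (IsCMField.complexConj L) (qsForm L) (IsCMField.complexConj_ne_one L) w hw g :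
        ↥(unitaryGroupOfForm (galAdicCompletionMap (L := L) (IsCMField.complexConj L) hw) (placeForm (qsForm L) w.1))) : GL (Fin 3) (w.1.adicCompletion L)))

/-! ## §1 The torus elements `d(1,b,1)` lie in `I` -/


include heA in
/-- **An element of `G_v` with matrix `diag(1, b, 1)`, `b ∈ E¹_v`, lies in the Iwahori level `I = K0 ⊓ K1`** (its `eA`-image is `diag(1, b_w, 1)`, integral with vanishing
`(1,0),(2,0),(2,1)` entries: ★ `mem_glInt_inf_conj_glInt_iff`). [cite: Tits1979, §3.7] [cite: Rogawski1990, §1.10 p. 9] -/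
theorem mem_I_of_coe_eq_diagonal (hns : ∀ w' : PlacesOver L v, IsCMField.complexConj L • w'.1 = w'.1)
    {ϖ : w.1.adicCompletion L} (hϖ : Valued.v ϖ = WithZero.exp (-1 : ℤ))
    (g₁ : GL (Fin 3) (w.1.adicCompletion L)) (hg₁ : (g₁ : Matrix (Fin 3) (Fin 3) (w.1.adicCompletion L)) = Matrix.diagonal ![(1 : w.1.adicCompletion L), 1, ϖ])
    (K0 K1 I : Subgroup (Gqs L v))
    (hK0 : K0 = ((glInt 3 (w.1.adicCompletion L)).subgroupOf
      (unitaryGroupOfForm (galAdicCompletionMap (L := L) (IsCMField.complexConj L) hw) ((StdForm.antidiagonal 3).over (w.1.adicCompletion L)))).comap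
        eA.toMulEquiv.toMonoidHom)
    (hK1 : K1 = (((glInt 3 (w.1.adicCompletion L)).map (MulAut.conj g₁).toMonoidHom).subgroupOf
      (unitaryGroupOfForm (galAdicCompletionMap (L := L) (IsCMField.complexConj L) hw) ((StdForm.antidiagonal 3).over (w.1.adicCompletion L)))).comap
        eA.toMulEquiv.toMonoidHom)
    (hI : I = K0 ⊓ K1)
    (b : ↥(normOneUnits (conjLocal L (IsCMField.complexConj L) v))) (g : Gqs L v)
    (hg : (g.val.val : Matrix (Fin 3) (Fin 3) (LocalRing L v)) =
      Matrix.diagonal ![(1 : LocalRing L v), ((b : (LocalRing L v)ˣ) : LocalRing L v), 1]) :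
    g ∈ I := by
  subst hI hK0 hK1
  rw [Subgroup.mem_inf, Subgroup.mem_comap, Subgroup.mem_comap]
  change eA g ∈ (glInt 3 (w.1.adicCompletion L)).subgroupOf _ ∧ eA g ∈ ((glInt 3 (w.1.adicCompletion L)).map (MulAut.conj g₁).toMonoidHom).subgroupOf _
  rw [← Subgroup.mem_inf, mem_glInt_inf_conj_glInt_iff (galAdicCompletionMap (L := L) (IsCMField.complexConj L) hw) rfl (fun a => valued_galAdicCompletionMap (L := L) (IsCMField.complexConj L) hw a) hϖ g₁ hg₁]
  have hb1 : Valued.v (((b : (LocalRing L v)ˣ) : LocalRing L v) w) = 1 :=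
    F0P3cStCharTSTorusCompactPart.valued_apply_eq_one_of_mem_normOneUnits L v hns b.2 w
  have hent : ∀ i j : Fin 3, (((eA g : ↥(unitaryGroupOfForm (galAdicCompletionMap (L := L) (IsCMField.complexConj L) hw)
      ((StdForm.antidiagonal 3).over (w.1.adicCompletion L)))) : GL (Fin 3) (w.1.adicCompletion L)) : Matrix (Fin 3) (Fin 3) (w.1.adicCompletion L)) i j =
        (Matrix.diagonal ![(1 : LocalRing L v), ((b : (LocalRing L v)ˣ) : LocalRing L v), 1] i j) w := by
    intro i j
    rw [coe_eA_apply L v w hw eA heA g i j, hg]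
  refine ⟨fun i j => ?_, ?_, ?_, ?_⟩
  · rw [hent, Matrix.diagonal_apply]
    split_ifs with hij
    · subst hij
      fin_cases i
      · show Valued.v (((1 : LocalRing L v)) w) ≤ 1
        rw [Pi.one_apply, map_one]
      · exact hb1.le
      · show Valued.v (((1 : LocalRing L v)) w) ≤ 1
        rw [Pi.one_apply, map_one]
    · rw [Pi.zero_apply, map_zero]; exact zero_le
  · rw [hent, Matrix.diagonal_apply_ne _ (by decide), Pi.zero_apply, map_zero]; exact zero_lt_one
  · rw [hent, Matrix.diagonal_apply_ne _ (by decide), Pi.zero_apply, map_zero]; exact zero_lt_one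
  · rw [hent, Matrix.diagonal_apply_ne _ (by decide), Pi.zero_apply, map_zero]; exact zero_lt_one


/-! ## §2 MACKEY binders at `I` and `K1` over the uniformiser token -/

include heA in
/-- **MACKEY's `hcover` at `H := B_v`, `K := I`, `ι := Fin 2`, `g := ![1, eA⁻¹ w]`** (★ `cover_borelU_inf` in the model, pulled back along `eA`). [cite: BruhatTits1972, (4.4.4)]
[cite: Casselman1995, Prop. 1.3.1] -/
theorem cover_borel_I {ϖ : w.1.adicCompletion L} (hϖ : Valued.v ϖ = WithZero.exp (-1 : ℤ))
    (g₁ : GL (Fin 3) (w.1.adicCompletion L)) (hg₁ : (g₁ : Matrix (Fin 3) (Fin 3) (w.1.adicCompletion L)) = Matrix.diagonal ![(1 : w.1.adicCompletion L), 1, ϖ])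
    (K0 K1 I : Subgroup (Gqs L v))
    (hK0 : K0 = ((glInt 3 (w.1.adicCompletion L)).subgroupOf
      (unitaryGroupOfForm (galAdicCompletionMap (L := L) (IsCMField.complexConj L) hw) ((StdForm.antidiagonal 3).over (w.1.adicCompletion L)))).comap
        eA.toMulEquiv.toMonoidHom)
    (hK1 : K1 = (((glInt 3 (w.1.adicCompletion L)).map (MulAut.conj g₁).toMonoidHom).subgroupOf
      (unitaryGroupOfForm (galAdicCompletionMap (L := L) (IsCMField.complexConj L) hw) ((StdForm.antidiagonal 3).over (w.1.adicCompletion L)))).comap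
        eA.toMulEquiv.toMonoidHom)
    (hI : I = K0 ⊓ K1) :
    ∀ y : ↥(unitaryGroupOfForm (conjLocal L (IsCMField.complexConj L) v) (cmLocalForm L 3 v)), ∃ i : Fin 2, ∃ h : ↥(cmBorelTriple L 3 v).P, ∃ κ : ↥(unitaryGroupOfForm (conjLocal L (IsCMField.complexConj L) v) (cmLocalForm L 3 v)), κ ∈ I ∧
      y = (h : ↥(unitaryGroupOfForm (conjLocal L (IsCMField.complexConj L) v) (cmLocalForm L 3 v))) * (![(1 : ↥(unitaryGroupOfForm (conjLocal L (IsCMField.complexConj L) v) (cmLocalForm L 3 v))), eA.symm (weylLongU (galAdicCompletionMap (L := L) (IsCMField.complexConj L) hw) (rfl : (StdForm.antidiagonal 3).over (w.1.adicCompletion L) = _))] i) * κ := by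
  subst hI hK0 hK1
  intro y
  let eU : ↥(unitaryGroupOfForm (conjLocal L (IsCMField.complexConj L) v) (cmLocalForm L 3 v)) ≃ₜ* ↥(unitaryGroupOfForm (galAdicCompletionMap (L := L) (IsCMField.complexConj L) hw) ((StdForm.antidiagonal 3).over (w.1.adicCompletion L))) := eA
  obtain ⟨i, b, κ', hκ', hy⟩ := cover_borelU_inf (galAdicCompletionMap (L := L) (IsCMField.complexConj L) hw) rfl (galAdicCompletionMap_galAdicCompletionMap_of_smul_eq (IsCMField.complexConj L) w (IsCMField.complexConj_ne_one L) hw) (fun a => valued_galAdicCompletionMap (L := L) (IsCMField.complexConj L) hw a) hϖ g₁ hg₁ (eU y)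
  refine ⟨i, ⟨eU.symm b, eA_symm_mem_borel L v w hw eA heA b.2⟩, eU.symm κ', ?_, ?_⟩
  · exact Subgroup.mem_inf.2 ⟨(symm_mem_comap_iff L v w hw eA _ _).2 (Subgroup.mem_inf.1 hκ').1,
      (symm_mem_comap_iff L v w hw eA _ _).2 (Subgroup.mem_inf.1 hκ').2⟩
  · apply eU.injective
    rw [map_mul, map_mul]
    change eU y = eU (eU.symm _) * eU (![(1 : ↥(unitaryGroupOfForm (conjLocal L (IsCMField.complexConj L) v) (cmLocalForm L 3 v))), eA.symm (weylLongU (galAdicCompletionMap (L := L) (IsCMField.complexConj L) hw) (rfl : (StdForm.antidiagonal 3).over (w.1.adicCompletion L) = _))] i) * eU (eU.symm κ')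
    rw [ContinuousMulEquiv.apply_symm_apply, ContinuousMulEquiv.apply_symm_apply, eA_vec L v w hw eA i]
    exact hy

include heA in
/-- **MACKEY's `hdisj`** for the same data (★ `disj_borelU_inf`, pushed forward along `eA`). [cite: BruhatTits1972, (4.4.4)] [cite: Casselman1995, Prop. 1.3.1] -/
theorem disj_borel_I {ϖ : w.1.adicCompletion L} (hϖ : Valued.v ϖ = WithZero.exp (-1 : ℤ))
    (g₁ : GL (Fin 3) (w.1.adicCompletion L)) (hg₁ : (g₁ : Matrix (Fin 3) (Fin 3) (w.1.adicCompletion L)) = Matrix.diagonal ![(1 : w.1.adicCompletion L), 1, ϖ])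
    (K0 K1 I : Subgroup (Gqs L v))
    (hK0 : K0 = ((glInt 3 (w.1.adicCompletion L)).subgroupOf
      (unitaryGroupOfForm (galAdicCompletionMap (L := L) (IsCMField.complexConj L) hw) ((StdForm.antidiagonal 3).over (w.1.adicCompletion L)))).comap
        eA.toMulEquiv.toMonoidHom)
    (hK1 : K1 = (((glInt 3 (w.1.adicCompletion L)).map (MulAut.conj g₁).toMonoidHom).subgroupOf
      (unitaryGroupOfForm (galAdicCompletionMap (L := L) (IsCMField.complexConj L) hw) ((StdForm.antidiagonal 3).over (w.1.adicCompletion L)))).comap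
        eA.toMulEquiv.toMonoidHom)
    (hI : I = K0 ⊓ K1) :
    ∀ i j : Fin 2, (∃ h : ↥(cmBorelTriple L 3 v).P, ∃ κ : ↥(unitaryGroupOfForm (conjLocal L (IsCMField.complexConj L) v) (cmLocalForm L 3 v)), κ ∈ I ∧
      (![(1 : ↥(unitaryGroupOfForm (conjLocal L (IsCMField.complexConj L) v) (cmLocalForm L 3 v))), eA.symm (weylLongU (galAdicCompletionMap (L := L) (IsCMField.complexConj L) hw) (rfl : (StdForm.antidiagonal 3).over (w.1.adicCompletion L) = _))] j) = (h : ↥(unitaryGroupOfForm (conjLocal L (IsCMField.complexConj L) v) (cmLocalForm L 3 v))) * (![(1 : ↥(unitaryGroupOfForm (conjLocal L (IsCMField.complexConj L) v) (cmLocalForm L 3 v))), eA.symm (weylLongU (galAdicCompletionMap (L := L) (IsCMField.complexConj L) hw) (rfl : (StdForm.antidiagonal 3).over (w.1.adicCompletion L) = _))] i) * κ) → i = j := by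
  subst hI hK0 hK1
  rintro i j ⟨h, κ, hκ, e⟩
  let eU : ↥(unitaryGroupOfForm (conjLocal L (IsCMField.complexConj L) v) (cmLocalForm L 3 v)) ≃ₜ* ↥(unitaryGroupOfForm (galAdicCompletionMap (L := L) (IsCMField.complexConj L) hw) ((StdForm.antidiagonal 3).over (w.1.adicCompletion L))) := eA
  have hb : eU (h : ↥(unitaryGroupOfForm (conjLocal L (IsCMField.complexConj L) v) (cmLocalForm L 3 v))) ∈ borelU (galAdicCompletionMap (L := L) (IsCMField.complexConj L) hw) ((StdForm.antidiagonal 3).over (w.1.adicCompletion L)) :=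
    (eA_mem_borelU_iff L v w hw eA heA _).2 h.2
  have hκ' : eU κ ∈ (glInt 3 (w.1.adicCompletion L)).subgroupOf _ ⊓ ((glInt 3 (w.1.adicCompletion L)).map (MulAut.conj g₁).toMonoidHom).subgroupOf _ :=
    Subgroup.mem_inf.2 ⟨(mem_comap_iff L v w hw eA _ _).1 (Subgroup.mem_inf.1 hκ).1, (mem_comap_iff L v w hw eA _ _).1 (Subgroup.mem_inf.1 hκ).2⟩
  refine disj_borelU_inf (galAdicCompletionMap (L := L) (IsCMField.complexConj L) hw) rfl (fun a => valued_galAdicCompletionMap (L := L) (IsCMField.complexConj L) hw a) hϖ g₁ hg₁ i j ⟨⟨_, hb⟩, eU κ, hκ', ?_⟩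
  calc ![(1 : ↥(unitaryGroupOfForm (galAdicCompletionMap (L := L) (IsCMField.complexConj L) hw) ((StdForm.antidiagonal 3).over (w.1.adicCompletion L)))), weylLongU (galAdicCompletionMap (L := L) (IsCMField.complexConj L) hw) (rfl : (StdForm.antidiagonal 3).over (w.1.adicCompletion L) = _)] j
      = eU (![(1 : ↥(unitaryGroupOfForm (conjLocal L (IsCMField.complexConj L) v) (cmLocalForm L 3 v))), eA.symm (weylLongU (galAdicCompletionMap (L := L) (IsCMField.complexConj L) hw) (rfl : (StdForm.antidiagonal 3).over (w.1.adicCompletion L) = _))] j) := (eA_vec L v w hw eA j).symm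
    _ = eU ((h : ↥(unitaryGroupOfForm (conjLocal L (IsCMField.complexConj L) v) (cmLocalForm L 3 v))) * (![(1 : ↥(unitaryGroupOfForm (conjLocal L (IsCMField.complexConj L) v) (cmLocalForm L 3 v))), eA.symm (weylLongU (galAdicCompletionMap (L := L) (IsCMField.complexConj L) hw) (rfl : (StdForm.antidiagonal 3).over (w.1.adicCompletion L) = _))] i) * κ) := by rw [e]
    _ = eU (h : ↥(unitaryGroupOfForm (conjLocal L (IsCMField.complexConj L) v) (cmLocalForm L 3 v))) * ![(1 : ↥(unitaryGroupOfForm (galAdicCompletionMap (L := L) (IsCMField.complexConj L) hw) ((StdForm.antidiagonal 3).over (w.1.adicCompletion L)))), weylLongU (galAdicCompletionMap (L := L) (IsCMField.complexConj L) hw) (rfl : (StdForm.antidiagonal 3).over (w.1.adicCompletion L) = _)] i * eU κ := by rw [map_mul, map_mul, eA_vec L v w hw eA i]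

include heA in
/-- **MACKEY's `hcover` at `H := B_v`, `K := K1`, `ι := Unit`, `g := fun _ => 1`** (★ `cover_borelU_conj_glInt`, pulled back along `eA`). [cite: Tits1979, §3.3.2]
[cite: Casselman1995, Prop. 1.3.1] -/
theorem cover_borel_K1 {ϖ : w.1.adicCompletion L} (hϖ : Valued.v ϖ = WithZero.exp (-1 : ℤ))
    (g₁ : GL (Fin 3) (w.1.adicCompletion L)) (hg₁ : (g₁ : Matrix (Fin 3) (Fin 3) (w.1.adicCompletion L)) = Matrix.diagonal ![(1 : w.1.adicCompletion L), 1, ϖ])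
    (K1 : Subgroup (Gqs L v))
    (hK1 : K1 = (((glInt 3 (w.1.adicCompletion L)).map (MulAut.conj g₁).toMonoidHom).subgroupOf
      (unitaryGroupOfForm (galAdicCompletionMap (L := L) (IsCMField.complexConj L) hw) ((StdForm.antidiagonal 3).over (w.1.adicCompletion L)))).comap
        eA.toMulEquiv.toMonoidHom) :
    ∀ y : ↥(unitaryGroupOfForm (conjLocal L (IsCMField.complexConj L) v) (cmLocalForm L 3 v)), ∃ _ : Unit, ∃ h : ↥(cmBorelTriple L 3 v).P, ∃ κ : ↥(unitaryGroupOfForm (conjLocal L (IsCMField.complexConj L) v) (cmLocalForm L 3 v)), κ ∈ K1 ∧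
      y = (h : ↥(unitaryGroupOfForm (conjLocal L (IsCMField.complexConj L) v) (cmLocalForm L 3 v))) * ((fun _ : Unit => (1 : ↥(unitaryGroupOfForm (conjLocal L (IsCMField.complexConj L) v) (cmLocalForm L 3 v)))) ()) * κ := by
  subst hK1
  intro y
  let eU : ↥(unitaryGroupOfForm (conjLocal L (IsCMField.complexConj L) v) (cmLocalForm L 3 v)) ≃ₜ* ↥(unitaryGroupOfForm (galAdicCompletionMap (L := L) (IsCMField.complexConj L) hw) ((StdForm.antidiagonal 3).over (w.1.adicCompletion L))) := eA
  obtain ⟨_, b, κ', hκ', hy⟩ := cover_borelU_conj_glInt (galAdicCompletionMap (L := L) (IsCMField.complexConj L) hw) rfl (galAdicCompletionMap_galAdicCompletionMap_of_smul_eq (IsCMField.complexConj L) w (IsCMField.complexConj_ne_one L) hw) (fun a => valued_galAdicCompletionMap (L := L) (IsCMField.complexConj L) hw a) hϖ g₁ hg₁ (eU y)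
  refine ⟨(), ⟨eU.symm b, eA_symm_mem_borel L v w hw eA heA b.2⟩, eU.symm κ', (symm_mem_comap_iff L v w hw eA _ _).2 hκ', ?_⟩
  apply eU.injective
  rw [map_mul, map_mul, map_one]
  change eU y = eU (eU.symm _) * 1 * eU (eU.symm κ')
  rw [ContinuousMulEquiv.apply_symm_apply, ContinuousMulEquiv.apply_symm_apply]
  exact hy


end Summit.HodgeConjecture.HodgeConjecture.Cruxes.H413.F0P3cStCharTSStLevelsPF

end
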